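import Summits.KontsevichZagierPeriods.KontsevichZagierPeriods.Theorems.UnfoldedStokesStokesGenerationFibrewiseClosure
import Summits.KontsevichZagierPeriods.KontsevichZagierPeriods.Theorems.UnfoldedStokesStokesGenerationStubFibrewiseCalibrationBands
import Summits.KontsevichZagierPeriods.KontsevichZagierPeriods.Theorems.UnfoldedStokesStokesGenerationStubRungClampedAngularCertificateAux

/-!
# `StokesGeneration` (stmt-KontsevichZagierPeriods-3586) — line `fibrewise_stokes`, stub `stub_clampedNewtonLeibniz`

Registered rung-8 stub (W6, converse programme) of the line `fibrewise_stokes` of the crux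
`StokesGeneration` (route UnfoldedStokes): **the cubified Newton–Leibniz move is ONE fibrewise Stokes
element along the last coordinate.**

Data: `ℚ`-semialgebraic sections `0 ≤ a ≤ b ≤ 1` on the closed cube `[0,1]ⁿ`, a primitive `F`,
`ℚ`-semialgebraic and bounded on the closed band `{a x ≤ t ≤ b x}`, continuous along each closed fibre
`[a x, b x]` and differentiable along the open fibre with derivative `f` (a `ℚ`-semialgebraic function
on `[0,1]ⁿ⁺¹`, integrable on the band). On the cube `[0,1]ⁿ⁺¹`, Kontsevich–Zagier's rule (3) becomes the
function `1_{a x < t < b x} · f − (F (x, b x) − F (x, a x))`, and this is the fibrewise Stokes element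
`D − (G|_{t=1} − G|_{t=0})` with

* the CLAMPED primitive `G (x, t) = F (x, max (a x) (min t (b x)))` — constant in `t` below `a x` and
  above `b x`, equal to `F` inside the band; bounded by the bound of `F`; continuous in `t ∈ [0,1]`
  (the clamp is continuous with values in `[a x, b x]`); `ℚ`-semialgebraic (`min`, `max` and
  composition, Bochnak–Coste–Roy Prop. 2.2.6);
* the fibre derivative `D = 1_{open band} · f`: inside the open band `G (x, ·)` is `F (x, ·)` near `t`,
  outside the closed band it is locally constant;
* the kink set `K = graph a ∪ graph b` (`ℚ`-semialgebraic, at most two points on each `t`-fibre);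
* the face `G|_{t=1} − G|_{t=0} = F (x, b x) − F (x, a x)` because `0 ≤ a ≤ b ≤ 1`.

The carried closed-cube representation has the integrand `D − (F (x, b x) − F (x, a x))`
(`ℚ`-semialgebraic; integrable: `f` on the band by hypothesis, the face term is bounded and
`ℚ`-semialgebraic), and `fibStokesDecomposable_element` concludes.

References: M. Kontsevich, D. Zagier, *Periods* (2001), §1.2 (rule (3), Newton–Leibniz);
J. Bochnak, M. Coste, M.-F. Roy, *Real Algebraic Geometry* (1998), §2.2 (Prop. 2.2.6);
J. Ayoub, Ann. of Math. 181 (2015), Rem. 1.5.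
-/

noncomputable section

-- `Summit.KontsevichZagierPeriods.KontsevichZagierPeriods.…` is the tree's mandated layout (single-conjunct summit).
set_option linter.dupNamespace false

namespace Summit.KontsevichZagierPeriods.KontsevichZagierPeriods.Cruxes.StokesGeneration.FibrewiseStokes

open MeasureTheory Set Filter Topology
open Literature.NumberTheory.Transcendental
open Literature.NumberTheory.Transcendental.KZ
open Literature.ModelTheory.ExponentialFields (IsSemialgebraic)

/-! ### The clamp `s ↦ max a₀ (min s b₀)` onto `[a₀, b₀]` -/

/-- The clamp takes values in `[a₀, b₀]` (`a₀ ≤ b₀`). [folklore] -/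
theorem clampNL_mem_Icc {a₀ b₀ : ℝ} (hab : a₀ ≤ b₀) (s : ℝ) : max a₀ (min s b₀) ∈ Set.Icc a₀ b₀ :=
  ⟨le_max_left _ _, max_le hab (min_le_right _ _)⟩

/-- On `[a₀, b₀]` the clamp is the identity. [folklore] -/
theorem clampNL_of_mem {a₀ b₀ s : ℝ} (hs : s ∈ Set.Icc a₀ b₀) : max a₀ (min s b₀) = s := by
  rw [min_eq_left hs.2, max_eq_right hs.1]

/-- Below `a₀` the clamp is `a₀`. [folklore] -/
theorem clampNL_of_le {a₀ b₀ s : ℝ} (hs : s ≤ a₀) : max a₀ (min s b₀) = a₀ :=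
  max_eq_left ((min_le_left _ _).trans hs)

/-- Above `b₀` the clamp is `b₀` (`a₀ ≤ b₀`). [folklore] -/
theorem clampNL_of_ge {a₀ b₀ s : ℝ} (hab : a₀ ≤ b₀) (hs : b₀ ≤ s) : max a₀ (min s b₀) = b₀ := by
  rw [min_eq_right hs, max_eq_right hab]

/-- A function continuous on `[a₀, b₀]` becomes continuous on the line after clamping its argument.
[folklore] -/
theorem clampNL_continuous {φ : ℝ → ℝ} {a₀ b₀ : ℝ} (hab : a₀ ≤ b₀)
    (hφ : ContinuousOn φ (Set.Icc a₀ b₀)) : Continuous fun s => φ (max a₀ (min s b₀)) :=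
  hφ.comp_continuous (continuous_const.max (continuous_id.min continuous_const))
    fun s => clampNL_mem_Icc hab s

/-- Inside `(a₀, b₀)` the clamped function has the derivative of the function. [folklore] -/
theorem clampNL_hasDerivAt_of_mem {φ : ℝ → ℝ} {a₀ b₀ t φ' : ℝ} (ht : t ∈ Set.Ioo a₀ b₀)
    (hφ : HasDerivAt φ φ' t) : HasDerivAt (fun s => φ (max a₀ (min s b₀))) φ' t := by
  refine hφ.congr_of_eventuallyEq ?_
  filter_upwards [Ioo_mem_nhds ht.1 ht.2] with s hs
  rw [clampNL_of_mem (Set.Ioo_subset_Icc_self hs)]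

/-- Below `a₀` the clamped function is locally constant. [folklore] -/
theorem clampNL_hasDerivAt_of_lt {φ : ℝ → ℝ} {a₀ b₀ t : ℝ} (ht : t < a₀) :
    HasDerivAt (fun s => φ (max a₀ (min s b₀))) 0 t := by
  refine (hasDerivAt_const t (φ a₀)).congr_of_eventuallyEq ?_
  filter_upwards [Iio_mem_nhds ht] with s hs
  rw [clampNL_of_le (b₀ := b₀) (le_of_lt hs)]

/-- Above `b₀` the clamped function is locally constant (`a₀ ≤ b₀`). [folklore] -/
theorem clampNL_hasDerivAt_of_gt {φ : ℝ → ℝ} {a₀ b₀ t : ℝ} (hab : a₀ ≤ b₀) (ht : b₀ < t) :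
    HasDerivAt (fun s => φ (max a₀ (min s b₀))) 0 t := by
  refine (hasDerivAt_const t (φ b₀)).congr_of_eventuallyEq ?_
  filter_upwards [Ioi_mem_nhds ht] with s hs
  rw [clampNL_of_ge hab (le_of_lt hs)]

/-! ### Semialgebraic bookkeeping over a band -/

/-- **Composition with a section of the band.** If `F` is `ℚ`-semialgebraic on the closed band
`{(x, t) | x ∈ T, a x ≤ t ≤ b x}` and `u` is a `ℚ`-semialgebraic function on a `ℚ`-semialgebraic set
`S` lying over `T` with `a (init z) ≤ u z ≤ b (init z)`, then `z ↦ F (init z, u z)` is `ℚ`-semialgebraic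
on `S` (the map `z ↦ (init z, u z)` is semialgebraic coordinatewise; composition is Bochnak–Coste–Roy
Prop. 2.2.6). [folklore] -/
theorem clampNL_sa_comp_snoc {n : ℕ} (T : Set (Fin n → ℝ)) (a b : (Fin n → ℝ) → ℝ)
    {F : (Fin (n + 1) → ℝ) → ℝ}
    (hF : IsSemialgebraicFunOn ℚ {z : Fin (n + 1) → ℝ | Fin.init z ∈ T ∧ a (Fin.init z) ≤ z (Fin.last n) ∧
      z (Fin.last n) ≤ b (Fin.init z)} F)
    {S : Set (Fin (n + 1) → ℝ)} (hS : IsSemialgebraic ℚ S) (hST : ∀ z ∈ S, Fin.init z ∈ T)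
    {u : (Fin (n + 1) → ℝ) → ℝ} (hu : IsSemialgebraicFunOn ℚ S u)
    (hu' : ∀ z ∈ S, u z ∈ Set.Icc (a (Fin.init z)) (b (Fin.init z))) :
    IsSemialgebraicFunOn ℚ S (fun z => F (Fin.snoc (Fin.init z) (u z))) := by
  have hmap : IsSemialgebraicMapOn ℚ S (fun z => (Fin.snoc (Fin.init z) (u z) : Fin (n + 1) → ℝ)) := by
    refine IsSemialgebraicMapOn.of_forall hS fun j => ?_
    refine Fin.lastCases ?_ (fun i => ?_) j
    · simpa only [Fin.snoc_last] using hu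
    · simp only [Fin.snoc_castSucc]
      exact isSemialgebraicFunOn_apply hS (Fin.castSucc i)
  refine IsSemialgebraicFunOn.comp_isSemialgebraicMapOn_holds hF hmap fun z hz => ?_
  simp only [Set.mem_setOf_eq, Fin.init_snoc, Fin.snoc_last]
  exact ⟨hST z hz, (hu' z hz).1, (hu' z hz).2⟩

/-- **The open band is semialgebraic.** For `ℚ`-semialgebraic `a`, `b` on `T`, the open band
`{(x, t) | x ∈ T, a x < t < b x}` is `ℚ`-semialgebraic (signs of the semialgebraic functions
`a (init z) − t`, `t − b (init z)` on the cylinder over `T`; graph elimination). [folklore] -/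
theorem clampNL_isSemialgebraic_openBand {n : ℕ} {T : Set (Fin n → ℝ)} {a b : (Fin n → ℝ) → ℝ}
    (ha : IsSemialgebraicFunOn ℚ T a) (hb : IsSemialgebraicFunOn ℚ T b) :
    IsSemialgebraic ℚ {z : Fin (n + 1) → ℝ | Fin.init z ∈ T ∧ a (Fin.init z) < z (Fin.last n) ∧
      z (Fin.last n) < b (Fin.init z)} := by
  have hcyl : IsSemialgebraic ℚ {z : Fin (n + 1) → ℝ | Fin.init z ∈ T} :=
    (IsSemialgebraicFunOn.isSemialgebraic_holds ha).setOf_init_mem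
  have ht : IsSemialgebraicFunOn ℚ {z : Fin (n + 1) → ℝ | Fin.init z ∈ T} (fun z => z (Fin.last n)) :=
    isSemialgebraicFunOn_apply hcyl (Fin.last n)
  have h1 := (ha.comp_init.fun_sub ht).isSemialgebraic_sep_neg
  have h2 := (ht.fun_sub hb.comp_init).isSemialgebraic_sep_neg
  convert h1.inter h2 using 1
  ext z
  simp only [Set.mem_setOf_eq, Set.mem_inter_iff, sub_neg]
  tauto

/-! ### The registered stub -/

/-- **Registered stub `stub_clampedNewtonLeibniz` (rung 8, W6 — converse programme): the cubified
Newton–Leibniz move is one fibrewise Stokes element along the last coordinate.** For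
`ℚ`-semialgebraic sections `0 ≤ a ≤ b ≤ 1` on `[0,1]ⁿ` and a fibrewise primitive `F` of `f` on the band
`{a x ≤ t ≤ b x}` (`F` bounded and `ℚ`-semialgebraic on the closed band, continuous on each closed fibre,
with derivative `f` on the open fibre, `f` integrable on the band), the cube function
`1_{a x < t < b x} · f − (F (x, b x) − F (x, a x))` is fibrewise-Stokes decomposable: it is the single
element with the clamped primitive `G (x, t) = F (x, max (a x) (min t (b x)))`, fibre derivative
`1_{open band} · f`, kink set `{t = a x} ∪ {t = b x}`, no padding, no null set.
[cite: KontsevichZagier2001, §1.2 rule (3)] -/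
theorem stub_clampedNewtonLeibniz :
    ∀ (n : ℕ) (a b : (Fin n → ℝ) → ℝ) (F f : (Fin (n + 1) → ℝ) → ℝ),
      IsSemialgebraicFunOn ℚ (Set.pi Set.univ (fun _ : Fin n => Set.Icc (0:ℝ) 1)) a →
      IsSemialgebraicFunOn ℚ (Set.pi Set.univ (fun _ : Fin n => Set.Icc (0:ℝ) 1)) b →
      (∀ x ∈ Set.pi Set.univ (fun _ : Fin n => Set.Icc (0:ℝ) 1), 0 ≤ a x ∧ a x ≤ b x ∧ b x ≤ 1) →
      IsSemialgebraicFunOn ℚ {z : Fin (n + 1) → ℝ | Fin.init z ∈ Set.pi Set.univ (fun _ : Fin n => Set.Icc (0:ℝ) 1) ∧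
        a (Fin.init z) ≤ z (Fin.last n) ∧ z (Fin.last n) ≤ b (Fin.init z)} F →
      IsSemialgebraicFunOn ℚ (Set.pi Set.univ (fun _ : Fin (n + 1) => Set.Icc (0:ℝ) 1)) f →
      (∃ C : ℝ, ∀ z ∈ {z : Fin (n + 1) → ℝ | Fin.init z ∈ Set.pi Set.univ (fun _ : Fin n => Set.Icc (0:ℝ) 1) ∧
        a (Fin.init z) ≤ z (Fin.last n) ∧ z (Fin.last n) ≤ b (Fin.init z)}, |F z| ≤ C) →
      (∀ x ∈ Set.pi Set.univ (fun _ : Fin n => Set.Icc (0:ℝ) 1),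
        ContinuousOn (fun t : ℝ => F (Fin.snoc x t)) (Set.Icc (a x) (b x))) →
      (∀ x ∈ Set.pi Set.univ (fun _ : Fin n => Set.Icc (0:ℝ) 1), ∀ t ∈ Set.Ioo (a x) (b x),
        HasDerivAt (fun s : ℝ => F (Fin.snoc x s)) (f (Fin.snoc x t)) t) →
      IntegrableOn f {z : Fin (n + 1) → ℝ | Fin.init z ∈ Set.pi Set.univ (fun _ : Fin n => Set.Icc (0:ℝ) 1) ∧
        a (Fin.init z) ≤ z (Fin.last n) ∧ z (Fin.last n) ≤ b (Fin.init z)} →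
      FibStokesDecomposable (n + 1) (fun z =>
        Set.indicator {z : Fin (n + 1) → ℝ | Fin.init z ∈ Set.pi Set.univ (fun _ : Fin n => Set.Icc (0:ℝ) 1) ∧
          a (Fin.init z) < z (Fin.last n) ∧ z (Fin.last n) < b (Fin.init z)} f z -
        (F (Fin.snoc (Fin.init z) (b (Fin.init z))) - F (Fin.snoc (Fin.init z) (a (Fin.init z))))) := by
  intro n a b F f ha hb hab hF hf hC hcont hder hint
  obtain ⟨C, hC⟩ := hC
  set Q : Set (Fin n → ℝ) := Set.pi Set.univ (fun _ : Fin n => Set.Icc (0:ℝ) 1) with hQdef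
  set Q' : Set (Fin (n + 1) → ℝ) := Set.pi Set.univ (fun _ : Fin (n + 1) => Set.Icc (0:ℝ) 1) with hQ'def
  set Bo : Set (Fin (n + 1) → ℝ) := {z : Fin (n + 1) → ℝ | Fin.init z ∈ Q ∧
    a (Fin.init z) < z (Fin.last n) ∧ z (Fin.last n) < b (Fin.init z)} with hBodef
  -- the cubes
  have hQ' : IsSemialgebraic ℚ Q' := by rw [hQ'def, ← cube_eq_pi]; exact isSemialgebraic_cube
  have hQ'vol : volume Q' ≠ ⊤ := by
    rw [hQ'def, ← cube_eq_pi, volume_cube]; exact ENNReal.one_ne_top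
  have hinit : ∀ z ∈ Q', Fin.init z ∈ Q := fun z hz i _ => hz (Fin.castSucc i) (Set.mem_univ _)
  have hab' : ∀ z ∈ Q', a (Fin.init z) ≤ b (Fin.init z) := fun z hz => (hab _ (hinit z hz)).2.1
  have hCsnoc : ∀ x ∈ Q, ∀ s ∈ Set.Icc (a x) (b x), |F (Fin.snoc x s)| ≤ C := fun x hx s hs =>
    hC (Fin.snoc x s) (by
      simp only [Set.mem_setOf_eq, Fin.init_snoc, Fin.snoc_last]
      exact ⟨hx, hs.1, hs.2⟩)
  -- semialgebraic atoms on `Q'`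
  have ha' : IsSemialgebraicFunOn ℚ Q' (fun z => a (Fin.init z)) :=
    ha.comp_init.mono (fun z hz => hinit z hz) hQ'
  have hb' : IsSemialgebraicFunOn ℚ Q' (fun z => b (Fin.init z)) :=
    hb.comp_init.mono (fun z hz => hinit z hz) hQ'
  have hlast : IsSemialgebraicFunOn ℚ Q' (fun z => z (Fin.last n)) := isSemialgebraicFunOn_apply hQ' (Fin.last n)
  have hcl : IsSemialgebraicFunOn ℚ Q'
      (fun z => max (a (Fin.init z)) (min (z (Fin.last n)) (b (Fin.init z)))) :=
    rungClamp_sa_max ha' (rungClamp_sa_min hlast hb')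
  have hFa : IsSemialgebraicFunOn ℚ Q' (fun z => F (Fin.snoc (Fin.init z) (a (Fin.init z)))) :=
    clampNL_sa_comp_snoc Q a b hF hQ' hinit ha' fun z hz => ⟨le_rfl, hab' z hz⟩
  have hFb : IsSemialgebraicFunOn ℚ Q' (fun z => F (Fin.snoc (Fin.init z) (b (Fin.init z)))) :=
    clampNL_sa_comp_snoc Q a b hF hQ' hinit hb' fun z hz => ⟨hab' z hz, le_rfl⟩
  -- the fibre derivative `D = 1_{Bo} f`: semialgebraic and integrable on `Q'`
  have hBo : IsSemialgebraic ℚ Bo := clampNL_isSemialgebraic_openBand ha hb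
  have h0 : IsSemialgebraicFunOn ℚ (Q' \ Bo) (fun _ => (0:ℝ)) :=
    (isSemialgebraicFunOn_const_natCast (hQ'.diff hBo) 0).congr fun _ _ => Nat.cast_zero
  have hD : IsSemialgebraicFunOn ℚ Q' (Bo.indicator f) := by
    rw [← Set.inter_union_sdiff Q' Bo]
    exact IsSemialgebraicFunOn.union (hf.mono Set.inter_subset_left (hQ'.inter hBo)) h0
      (fun z hz => Set.indicator_of_mem hz.2 f) (fun z hz => Set.indicator_of_notMem hz.2 f)
  have hDint : IntegrableOn (Bo.indicator f) Q' :=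
    (integrableOn_indicator_iff (IsSemialgebraic.measurableSet_holds hBo)).mpr
      (hint.mono_set fun z hz => ⟨hz.1.1, hz.1.2.1.le, hz.1.2.2.le⟩)
  -- the face term `F (x, b x) − F (x, a x)`: semialgebraic, bounded, integrable on `Q'`
  have hface : IsSemialgebraicFunOn ℚ Q'
      (fun z => F (Fin.snoc (Fin.init z) (b (Fin.init z))) - F (Fin.snoc (Fin.init z) (a (Fin.init z)))) :=
    hFb.fun_sub hFa
  have hface_bd : ∀ z ∈ Q',
      |F (Fin.snoc (Fin.init z) (b (Fin.init z))) - F (Fin.snoc (Fin.init z) (a (Fin.init z)))| ≤ C + C :=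
    fun z hz => (abs_sub _ _).trans (add_le_add (hCsnoc _ (hinit z hz) _ ⟨hab' z hz, le_rfl⟩)
      (hCsnoc _ (hinit z hz) _ ⟨le_rfl, hab' z hz⟩))
  have hface_int : IntegrableOn
      (fun z => F (Fin.snoc (Fin.init z) (b (Fin.init z))) - F (Fin.snoc (Fin.init z) (a (Fin.init z)))) Q' :=
    integrableOn_of_abs_le hQ' hQ'vol hface hface_bd
  -- the carried closed-cube representation
  let q : IntegralRep (n + 1) :=
    { domain := Q'
      integrand := fun z => Bo.indicator f z -
        (F (Fin.snoc (Fin.init z) (b (Fin.init z))) - F (Fin.snoc (Fin.init z) (a (Fin.init z))))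
      isSemialgebraic_domain := hQ'
      isSemialgebraicFunOn_integrand := hD.fun_sub hface
      integrableOn := hDint.sub' hface_int }
  -- the clamped primitive and its kink set
  set G : (Fin (n + 1) → ℝ) → ℝ := fun z =>
    F (Fin.snoc (Fin.init z) (max (a (Fin.init z)) (min (z (Fin.last n)) (b (Fin.init z))))) with hGdef
  set K : Set (Fin (n + 1) → ℝ) := {z : Fin (n + 1) → ℝ | Fin.init z ∈ Q ∧ z (Fin.last n) = a (Fin.init z)} ∪
    {z : Fin (n + 1) → ℝ | Fin.init z ∈ Q ∧ z (Fin.last n) = b (Fin.init z)} with hKdef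
  have hG : IsSemialgebraicFunOn ℚ Q' G :=
    clampNL_sa_comp_snoc Q a b hF hQ' hinit hcl fun z hz => clampNL_mem_Icc (hab' z hz) _
  have hK : IsSemialgebraic ℚ K := (isSemialgebraicFunOn_iff.mp ha).union (isSemialgebraicFunOn_iff.mp hb)
  have hGupd : ∀ (z : Fin (n + 1) → ℝ) (s : ℝ), G (Function.update z (Fin.last n) s) =
      F (Fin.snoc (Fin.init z) (max (a (Fin.init z)) (min s (b (Fin.init z))))) := by
    intro z s
    simp only [hGdef, Fin.init_update_last, Function.update_self]
  have hGbd : ∃ B : ℝ, ∀ z ∈ Q', |G z| ≤ B :=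
    ⟨C, fun z hz => hCsnoc _ (hinit z hz) _ (clampNL_mem_Icc (hab' z hz) (z (Fin.last n)))⟩
  have hfin : ∀ z ∈ Q', Set.Finite {s : ℝ | Function.update z (Fin.last n) s ∈ K} := by
    intro z _
    refine ((Set.finite_singleton (b (Fin.init z))).insert (a (Fin.init z))).subset fun s hs => ?_
    simp only [hKdef, Set.mem_setOf_eq, Set.mem_union, Fin.init_update_last, Function.update_self] at hs
    rcases hs with h | h
    · exact Or.inl h.2
    · exact Or.inr h.2
  have hGcont : ∀ z ∈ Q', ContinuousOn (fun s : ℝ => G (Function.update z (Fin.last n) s)) (Set.Icc (0:ℝ) 1) := by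
    intro z hz
    simp only [hGupd]
    exact (clampNL_continuous (hab' z hz) (hcont _ (hinit z hz))).continuousOn
  have hGder : ∀ z ∈ Q', z ∉ K → z (Fin.last n) ∈ Set.Ioo (0:ℝ) 1 →
      HasDerivAt (fun s : ℝ => G (Function.update z (Fin.last n) s)) (Bo.indicator f z) (z (Fin.last n)) := by
    intro z hz hzK _
    simp only [hGupd]
    have hx : Fin.init z ∈ Q := hinit z hz
    have hzK' : z (Fin.last n) ≠ a (Fin.init z) ∧ z (Fin.last n) ≠ b (Fin.init z) := by
      simp only [hKdef, Set.mem_union, Set.mem_setOf_eq, not_or, not_and] at hzK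
      exact ⟨hzK.1 hx, hzK.2 hx⟩
    rcases lt_or_gt_of_ne hzK'.1 with h1 | h1
    · -- below the band: `D z = 0`, the clamped primitive is locally constant
      rw [Set.indicator_of_notMem (fun h : z ∈ Bo => lt_asymm h1 h.2.1)]
      exact clampNL_hasDerivAt_of_lt (φ := fun s => F (Fin.snoc (Fin.init z) s)) h1
    · rcases lt_or_gt_of_ne hzK'.2 with h2 | h2
      · -- inside the open band: `D z = f z`, the clamped primitive is `F (x, ·)` near `t`
        rw [Set.indicator_of_mem (show z ∈ Bo from ⟨hx, h1, h2⟩)]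
        have hd := hder _ hx _ ⟨h1, h2⟩
        rw [Fin.snoc_init_self] at hd
        exact clampNL_hasDerivAt_of_mem (φ := fun s => F (Fin.snoc (Fin.init z) s)) ⟨h1, h2⟩ hd
      · -- above the band: `D z = 0`
        rw [Set.indicator_of_notMem (fun h : z ∈ Bo => lt_asymm h2 h.2.2)]
        exact clampNL_hasDerivAt_of_gt (φ := fun s => F (Fin.snoc (Fin.init z) s)) (hab' z hz) h2
  -- one fibrewise Stokes element along the last coordinate
  refine fibStokesDecomposable_element (n + 1) (Fin.last n) G (Bo.indicator f) K q hG hD hK hGbd hfin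
    hGcont hGder rfl fun z hz => ?_
  obtain ⟨h0, -, h1⟩ := hab _ (hinit z hz)
  show Bo.indicator f z - (F (Fin.snoc (Fin.init z) (b (Fin.init z))) - F (Fin.snoc (Fin.init z) (a (Fin.init z)))) =
    Bo.indicator f z - (G (Function.update z (Fin.last n) 1) - G (Function.update z (Fin.last n) 0))
  rw [hGupd, hGupd, clampNL_of_ge (hab' z hz) h1, clampNL_of_le h0]

end Summit.KontsevichZagierPeriods.KontsevichZagierPeriods.Cruxes.StokesGeneration.FibrewiseStokes

end
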